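import Mathlib
import Summits.FinalStateConjecture.FinalStateConjecture.Theses.PhaseMixingCapture
import Literature.Geometry.Lorentzian.TameGenericityLocal
import Literature.Geometry.Lorentzian.TameGenericityDiagonal
import Literature.Geometry.Lorentzian.AdmissibleMGHDExistence

/-!
# Sketch — crux-ideate, ideator 1, crux `PhaseMixingCapture.WeakCosmicCensorshipTame`
(stmt-FinalStateConjecture-17269)

First lemma of the idea card `overfocus-only-osculation` of this seat (PROVED), with the door it
uses and the typed Transfer:

* §1 the DOOR (proved): the crux follows from a LOCAL CENSORED EXIT at naked data
  (`NakedTameCensoredExit`) plus the Choquet-Bruhat–Geroch named fact;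
* §2 card `overfocus-only-osculation`: one-sided cleanness w.r.t. a `C²` functional on a tame
  immersed injective 2-probe gives a tame immersed injective escaping CURVE (osculating parabola)
  — `osculating_escape`, PROVED; the Transfer `OverfocusingWall` and
  `weakCosmicCensorshipTame_of_overfocusingWall : CBG-fact → OverfocusingWall → crux`, PROVED;
  for contrast the two-sided Lipschitz-wall crossing lemma is recorded as a signature
  (`transversal_escape_of_graphWall`, PROVED; the sibling crux's `transversal_escape` shape).
-/

noncomputable section

open scoped Manifold ContDiff Topology
open Set Filter Function Metric

namespace Summit.FinalStateConjecture.FinalStateConjecture.Cruxes.WeakCosmicCensorshipTame.Ideator1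

open Literature.Geometry.Lorentzian
open Summit.FinalStateConjecture.FinalStateConjecture.Theses.PhaseMixingCapture
  (WeakCosmicCensorshipTame)

/-! ## §1 The door: local censored exit at naked data suffices -/

section Door

variable (X : Type) [TopologicalSpace X] [ChartedSpace E3 X]
  [IsManifold (𝓡 3) ((⊤ : ℕ∞) : WithTop ℕ∞) X] [T2Space X] [SecondCountableTopology X]
  [ConnectedSpace X]

/-- The crux property of a datum: an MGHD exists and every MGHD has complete `𝓘⁺`
(sojourn form). -/
def Censored (D : InitialDataSet (𝓡 3) X) : Prop :=
  (∃ 𝒟 : VacuumCauchyDevelopment D, 𝒟.IsMaximal) ∧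
    ∀ 𝒟 : VacuumCauchyDevelopment D, 𝒟.IsMaximal →
      Summit.FinalStateConjecture.HasCompleteNullInfinity 𝒟.toCauchyDevelopment

end Door

/-- **Local tame censored exit at naked data** (the common target of both cards; the CENSORED-only
landing, weaker than `TangentProfileCensorship.NakedDataTameExit` /
`CurvatureOrSymmetry.TameCurvatureModeExit`, which land in the full summit property): through every
admissible datum having a maximal vacuum Cauchy development with INCOMPLETE `𝓘⁺` pass one end `e`
and a tame, immersed, injective admissible curve `F`, `F 0 = D`, whose members with `0 < ‖c‖ < ε`
are censored. -/
def NakedTameCensoredExit : Prop :=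
  ∀ (X : Type) [TopologicalSpace X] [ChartedSpace E3 X] [IsManifold (𝓡 3) ((⊤ : ℕ∞) : WithTop ℕ∞) X]
    [T2Space X] [SecondCountableTopology X] [ConnectedSpace X],
    ∀ D ∈ admissibleVacuumData X,
      (∃ 𝒟 : VacuumCauchyDevelopment D, 𝒟.IsMaximal ∧
        ¬ Summit.FinalStateConjecture.HasCompleteNullInfinity 𝒟.toCauchyDevelopment) →
      ∃ (e : AFEnd X) (F : EuclideanSpace ℝ (Fin 1) → InitialDataSet (𝓡 3) X),
        InitialDataSet.IsTameDataFamily e 1 F ∧ InitialDataSet.IsImmersedAtZero 1 F ∧ F 0 = D ∧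
          Injective F ∧ (∀ c, F c ∈ admissibleVacuumData X) ∧
          ∃ ε > (0 : ℝ), ∀ c, c ≠ 0 → ‖c‖ < ε → Censored X (F c)

/-- **The door (proved).** Under the Choquet-Bruhat–Geroch fact, a local tame censored exit at
naked data gives the crux: an exceptional datum has (CBG) some MGHD, hence one with incomplete
`𝓘⁺`; the exit curve is made global by `isTameChristodoulouGeneric_of_local`. -/
theorem weakCosmicCensorshipTame_of_exit (hcbg : choquetBruhat_geroch_exists_mghd_cauchy)
    (hexit : NakedTameCensoredExit) : WeakCosmicCensorshipTame := by
  intro X _ _ _ _ _ _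
  refine InitialDataSet.isTameChristodoulouGeneric_of_local fun D hD hnot ↦ ?_
  have hmghd : ∃ 𝒟 : VacuumCauchyDevelopment D, 𝒟.IsMaximal :=
    hcbg.exists_isMaximal_of_mem_admissibleVacuumData hD
  have hnaked : ∃ 𝒟 : VacuumCauchyDevelopment D, 𝒟.IsMaximal ∧
      ¬ Summit.FinalStateConjecture.HasCompleteNullInfinity 𝒟.toCauchyDevelopment := by
    by_contra hall
    push_neg at hall
    exact hnot ⟨hmghd, hall⟩
  obtain ⟨e, F, hF, himm, h0, hinj, h𝓓, ε, hε, hP⟩ := hexit X D hD hnaked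
  exact ⟨e, F, hF, himm, h0, hinj, h𝓓, ε, hε, fun c hc hcε ↦ hP c hc hcε⟩

/-! ## §2 Card `overfocus-only-osculation`: one-sided cleanness suffices -/

section Osculation

variable {X : Type} [TopologicalSpace X] [ChartedSpace E3 X]
  [IsManifold (𝓡 3) ((⊤ : ℕ∞) : WithTop ℕ∞) X]

/-- Second-order remainder bound for a `C²` function vanishing at `0`. -/
theorem exists_quadratic_remainder {φ : EuclideanSpace ℝ (Fin 2) → ℝ} (hφ : ContDiff ℝ 2 φ)
    (hφ0 : φ 0 = 0) :
    ∃ K ρ : ℝ, 0 ≤ K ∧ 0 < ρ ∧ ∀ x : EuclideanSpace ℝ (Fin 2), ‖x‖ < ρ →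
      |φ x - fderiv ℝ φ 0 x| ≤ K * ‖x‖ ^ 2 := by
  have hdf : ContDiff ℝ 1 (fderiv ℝ φ) := hφ.fderiv_right (by norm_num)
  obtain ⟨K, t, ht, hK⟩ := (hdf.contDiffAt (x := 0)).exists_lipschitzOnWith
  obtain ⟨ρ, hρ, hball⟩ := Metric.mem_nhds_iff.mp ht
  refine ⟨K, ρ, K.coe_nonneg, hρ, fun x hx ↦ ?_⟩
  have hdiff : ∀ y ∈ closedBall (0 : EuclideanSpace ℝ (Fin 2)) ‖x‖, DifferentiableAt ℝ φ y :=
    fun y _ ↦ (hφ.differentiable (by norm_num)) y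
  have hbound : ∀ y ∈ closedBall (0 : EuclideanSpace ℝ (Fin 2)) ‖x‖,
      ‖fderiv ℝ φ y - fderiv ℝ φ 0‖ ≤ K * ‖x‖ := by
    intro y hy
    have hy' : ‖y‖ ≤ ‖x‖ := by simpa using hy
    have hyt : y ∈ t := hball (by simpa using lt_of_le_of_lt hy' hx)
    have h0t : (0 : EuclideanSpace ℝ (Fin 2)) ∈ t := mem_of_mem_nhds ht
    calc ‖fderiv ℝ φ y - fderiv ℝ φ 0‖ ≤ K * ‖y - 0‖ := hK.norm_sub_le hyt h0t
      _ = K * ‖y‖ := by rw [sub_zero]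
      _ ≤ K * ‖x‖ := by gcongr
  have hxs : x ∈ closedBall (0 : EuclideanSpace ℝ (Fin 2)) ‖x‖ := by
    simp [Metric.mem_closedBall, dist_zero_right]
  have hmv := (convex_closedBall (0 : EuclideanSpace ℝ (Fin 2)) ‖x‖).norm_image_sub_le_of_norm_fderiv_le'
    hdiff hbound (mem_closedBall_self (norm_nonneg x)) hxs
  simp only [hφ0, sub_zero] at hmv
  calc |φ x - fderiv ℝ φ 0 x| = ‖φ x - fderiv ℝ φ 0 x‖ := (Real.norm_eq_abs _).symm
    _ ≤ K * ‖x‖ * ‖x‖ := hmv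
    _ = K * ‖x‖ ^ 2 := by ring

/-- A non-zero functional on `ℝ²` has a unit-value vector and a non-zero kernel vector. -/
theorem exists_frame {ℓ : EuclideanSpace ℝ (Fin 2) →L[ℝ] ℝ} (hℓ : ℓ ≠ 0) :
    ∃ v w : EuclideanSpace ℝ (Fin 2), ℓ v = 1 ∧ ℓ w = 0 ∧ w ≠ 0 := by
  classical
  set e₀ : EuclideanSpace ℝ (Fin 2) := EuclideanSpace.single 0 1
  set e₁ : EuclideanSpace ℝ (Fin 2) := EuclideanSpace.single 1 1
  have hne : ℓ e₀ ≠ 0 ∨ ℓ e₁ ≠ 0 := by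
    by_contra h
    simp only [not_or, not_not] at h
    apply hℓ
    apply ContinuousLinearMap.coe_injective
    refine (EuclideanSpace.basisFun (Fin 2) ℝ).toBasis.ext fun i ↦ ?_
    fin_cases i
    · simpa [e₀] using h.1
    · simpa [e₁] using h.2
  -- kernel vector
  set w : EuclideanSpace ℝ (Fin 2) := (ℓ e₁) • e₀ - (ℓ e₀) • e₁ with hw
  have hℓw : ℓ w = 0 := by simp [hw, mul_comm]
  have hw0 : w ≠ 0 := by
    intro h0
    have h0' : ∀ i, w i = 0 := fun i ↦ by rw [h0]; rfl
    have hw₀ : w 0 = ℓ e₁ := by simp [hw, e₀, e₁]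
    have hw₁ : w 1 = - ℓ e₀ := by simp [hw, e₀, e₁]
    rcases hne with h | h
    · exact h (by simpa [hw₁] using h0' 1)
    · exact h (by simpa [hw₀] using h0' 0)
  -- unit-value vector
  obtain ⟨u, hu⟩ : ∃ u : EuclideanSpace ℝ (Fin 2), ℓ u ≠ 0 := by
    rcases hne with h | h
    · exact ⟨e₀, h⟩
    · exact ⟨e₁, h⟩
  refine ⟨(ℓ u)⁻¹ • u, w, ?_, hℓw, hw0⟩
  rw [map_smul, smul_eq_mul, inv_mul_cancel₀ hu]

/-- The norm of a vector of `ℝ¹` is the absolute value of its coordinate. -/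
theorem norm_fin_one (c : EuclideanSpace ℝ (Fin 1)) : ‖c‖ = |c 0| := by
  rw [EuclideanSpace.norm_eq]
  simp [Real.sqrt_sq_eq_abs]

theorem eq_zero_of_apply_fin_one {c : EuclideanSpace ℝ (Fin 1)} (h : c 0 = 0) : c = 0 := by
  ext i
  fin_cases i
  simpa using h

set_option maxHeartbeats 1000000 in
/-- **Osculating-parabola escape (first lemma of card `overfocus-only-osculation`).** Let `G` be a
tame, immersed, injective 2-parameter family of `𝓓`-data on the end `e`, and let `φ : ℝ² → ℝ` be
`C²` with `φ 0 = 0` and `dφ(0) ≠ 0` such that near `0` the OPEN SIDE `{φ > 0}` consists of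
parameters whose data satisfy `P` (one-sided cleanness: nothing is asked on `{φ ≤ 0}`). Then there
is a tame immersed injective CURVE of `𝓓`-data through `G 0` all of whose members off `0` satisfy
`P`: the parabola `c ↦ c • w + (κ c²) • v` with `dφ(0) w = 0 ≠ w`, `dφ(0) v > 0` and `κ` large lies
in `{φ > 0}` for small `c ≠ 0` (second-order Taylor), is smooth, injective and has non-zero velocity
`w` at `0`; tameness/immersion/injectivity compose (`IsTameDataFamily.comp_contDiff`,
`IsImmersedAtZero.comp_of_injective_fderiv`), and `exists_tameFamily_of_local` globalises. -/
theorem osculating_escape {e : AFEnd X} {𝓓 : Set (InitialDataSet (𝓡 3) X)}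
    {P : InitialDataSet (𝓡 3) X → Prop} {G : EuclideanSpace ℝ (Fin 2) → InitialDataSet (𝓡 3) X}
    (hG : InitialDataSet.IsTameDataFamily e 2 G) (himm : InitialDataSet.IsImmersedAtZero 2 G)
    (hinj : Injective G) (h𝓓 : ∀ c, G c ∈ 𝓓) {φ : EuclideanSpace ℝ (Fin 2) → ℝ}
    (hφ : ContDiff ℝ 2 φ) (hφ0 : φ 0 = 0) (hdφ : fderiv ℝ φ 0 ≠ 0)
    (hside : ∃ ε > (0 : ℝ), ∀ c, ‖c‖ < ε → 0 < φ c → P (G c)) :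
    ∃ F : EuclideanSpace ℝ (Fin 1) → InitialDataSet (𝓡 3) X,
      InitialDataSet.IsTameDataFamily e 1 F ∧ F 0 = G 0 ∧ Injective F ∧
        InitialDataSet.IsImmersedAtZero 1 F ∧ (∀ c, F c ∈ 𝓓) ∧ ∀ c ≠ 0, P (F c) := by
  obtain ⟨ε, hε, hside⟩ := hside
  set ℓ := fderiv ℝ φ 0 with hℓ
  obtain ⟨K, ρ, hK, hρ, hrem⟩ := exists_quadratic_remainder hφ hφ0
  obtain ⟨v, w, hv, hw, hw0⟩ := exists_frame hdφ
  -- the curvature of the parabola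
  set κ : ℝ := 2 * K * ‖w‖ ^ 2 + 1 with hκ
  have hκpos : 0 < κ := by positivity
  -- the parabola `γ c = (c 0) • w + (κ (c 0)²) • v`
  set γ : EuclideanSpace ℝ (Fin 1) → EuclideanSpace ℝ (Fin 2) :=
    fun c ↦ (c 0) • w + (κ * (c 0) ^ 2) • v with hγ
  have hproj : ContDiff ℝ ∞ (fun c : EuclideanSpace ℝ (Fin 1) ↦ c 0) :=
    contDiff_piLp_apply (p := 2) (i := (0 : Fin 1))
  have hγsmooth : ContDiff ℝ ∞ γ :=
    (hproj.smul contDiff_const).add ((contDiff_const.mul (hproj.pow 2)).smul contDiff_const)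
  have hγ0 : γ 0 = 0 := by simp [hγ]
  -- derivative of `γ` at `0`
  have hγderiv : HasFDerivAt γ
      ((PiLp.proj (𝕜 := ℝ) 2 (fun _ : Fin 1 ↦ ℝ) (0 : Fin 1)).smulRight w) 0 := by
    have h1 : HasFDerivAt (fun c : EuclideanSpace ℝ (Fin 1) ↦ (c 0) • w)
        ((PiLp.proj (𝕜 := ℝ) 2 (fun _ : Fin 1 ↦ ℝ) (0 : Fin 1)).smulRight w) 0 :=
      (PiLp.hasFDerivAt_apply (𝕜 := ℝ) 2 (0 : EuclideanSpace ℝ (Fin 1)) (0 : Fin 1)).smul_const w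
    have h2 : HasFDerivAt (fun c : EuclideanSpace ℝ (Fin 1) ↦ (κ * (c 0) ^ 2) • v)
        (0 : EuclideanSpace ℝ (Fin 1) →L[ℝ] EuclideanSpace ℝ (Fin 2)) 0 := by
      have h3 : HasFDerivAt (fun c : EuclideanSpace ℝ (Fin 1) ↦ κ * (c 0) ^ 2)
          (0 : EuclideanSpace ℝ (Fin 1) →L[ℝ] ℝ) 0 := by
        have := ((PiLp.hasFDerivAt_apply (𝕜 := ℝ) 2 (0 : EuclideanSpace ℝ (Fin 1)) (0 : Fin 1)).pow 2).const_mul κ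
        simpa using this
      simpa using h3.smul_const v
    have h12 := h1.add h2
    rw [add_zero] at h12
    exact h12
  have hγdiff : DifferentiableAt ℝ γ 0 := hγderiv.differentiableAt
  have hγfderiv_inj : Injective (fderiv ℝ γ 0) := by
    rw [hγderiv.fderiv]
    intro c c' h
    simp only [ContinuousLinearMap.smulRight_apply, PiLp.proj_apply] at h
    have h' : (c 0 - c' 0) • w = 0 := by
      rw [sub_smul, sub_eq_zero]; exact h
    have h'' : c 0 = c' 0 := by
      rcases smul_eq_zero.mp h' with h0 | h0
      · exact sub_eq_zero.mp h0
      · exact absurd h0 hw0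
    ext i
    fin_cases i
    simpa using h''
  -- `ℓ ∘ γ = κ t²`
  have hℓγ : ∀ c, ℓ (γ c) = κ * (c 0) ^ 2 := by
    intro c
    simp [hγ, hv, hw]
  -- injectivity of `γ`
  have hγinj : Injective γ := by
    intro c c' h
    have hsq : (c 0) ^ 2 = (c' 0) ^ 2 := by
      have := congrArg ℓ h
      rw [hℓγ, hℓγ] at this
      exact mul_left_cancel₀ hκpos.ne' this
    rcases sq_eq_sq_iff_eq_or_eq_neg.mp hsq with h0 | h0
    · ext i; fin_cases i; simpa using h0
    · -- `c 0 = - c' 0`: then `γ c - γ c' = (2 c 0) • w = 0`, so `c 0 = 0 = c' 0`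
      have hdiff : γ c - γ c' = (2 * c 0) • w := by
        simp only [hγ, h0]
        module
      rw [h, sub_self] at hdiff
      have h2 : 2 * c 0 = 0 := by
        rcases smul_eq_zero.mp hdiff.symm with h1 | h1
        · exact h1
        · exact absurd h1 hw0
      have hc : c 0 = 0 := by linarith
      have hc' : c' 0 = 0 := by linarith
      rw [eq_zero_of_apply_fin_one hc, eq_zero_of_apply_fin_one hc']
  -- positivity of `φ` along the parabola for small `c ≠ 0`
  set A : ℝ := ‖w‖ + κ * ‖v‖ + 1 with hA
  have hApos : 0 < A := by positivity
  set δ : ℝ := min 1 (min (ρ / A) (min (ε / A) (1 / (4 * (K * κ ^ 2 * ‖v‖ ^ 2) + 1)))) with hδ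
  have hδpos : 0 < δ := by positivity
  have hnormγ : ∀ c : EuclideanSpace ℝ (Fin 1), ‖c‖ ≤ 1 → ‖γ c‖ ≤ A * ‖c‖ := by
    intro c hc1
    have ht : |c 0| = ‖c‖ := (norm_fin_one c).symm
    calc ‖γ c‖ ≤ ‖(c 0) • w‖ + ‖(κ * (c 0) ^ 2) • v‖ := norm_add_le _ _
      _ = |c 0| * ‖w‖ + κ * |c 0| ^ 2 * ‖v‖ := by
          rw [norm_smul, norm_smul, Real.norm_eq_abs, Real.norm_eq_abs, abs_mul,
            abs_of_pos hκpos, abs_pow]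
      _ ≤ |c 0| * ‖w‖ + κ * |c 0| * ‖v‖ := by
          have : |c 0| ^ 2 ≤ |c 0| := by
            rw [ht]; nlinarith [norm_nonneg c]
          gcongr
      _ = (‖w‖ + κ * ‖v‖) * ‖c‖ := by rw [ht]; ring
      _ ≤ A * ‖c‖ := by gcongr; linarith
  have hgood : ∀ c : EuclideanSpace ℝ (Fin 1), c ≠ 0 → ‖c‖ < δ → ‖γ c‖ < ε ∧ 0 < φ (γ c) := by
    intro c hc hcδ
    have hc1 : ‖c‖ ≤ 1 := (hcδ.le.trans (min_le_left _ _))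
    have hcρ : ‖c‖ < ρ / A := lt_of_lt_of_le hcδ ((min_le_right _ _).trans (min_le_left _ _))
    have hcε : ‖c‖ < ε / A :=
      lt_of_lt_of_le hcδ ((min_le_right _ _).trans ((min_le_right _ _).trans (min_le_left _ _)))
    have hcs : ‖c‖ < 1 / (4 * (K * κ ^ 2 * ‖v‖ ^ 2) + 1) :=
      lt_of_lt_of_le hcδ ((min_le_right _ _).trans ((min_le_right _ _).trans (min_le_right _ _)))
    have hγρ : ‖γ c‖ < ρ := by
      calc ‖γ c‖ ≤ A * ‖c‖ := hnormγ c hc1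
        _ < A * (ρ / A) := by gcongr
        _ = ρ := by field_simp
    have hγε : ‖γ c‖ < ε := by
      calc ‖γ c‖ ≤ A * ‖c‖ := hnormγ c hc1
        _ < A * (ε / A) := by gcongr
        _ = ε := by field_simp
    refine ⟨hγε, ?_⟩
    have ht0 : c 0 ≠ 0 := fun h ↦ hc (eq_zero_of_apply_fin_one h)
    have htpos : 0 < (c 0) ^ 2 := by positivity
    have ht1 : (c 0) ^ 2 ≤ 1 := by
      have : |c 0| ≤ 1 := by rw [← norm_fin_one]; exact hc1
      nlinarith [abs_nonneg (c 0), sq_abs (c 0)]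
    have hts : (c 0) ^ 2 * (2 * (K * κ ^ 2 * ‖v‖ ^ 2)) ≤ 1 / 2 := by
      have h1 : |c 0| < 1 / (4 * (K * κ ^ 2 * ‖v‖ ^ 2) + 1) := by rw [← norm_fin_one]; exact hcs
      have h2 : 0 ≤ K * κ ^ 2 * ‖v‖ ^ 2 := by positivity
      have h3 : (c 0) ^ 2 ≤ |c 0| := by nlinarith [abs_nonneg (c 0), sq_abs (c 0)]
      have h4 : |c 0| * (4 * (K * κ ^ 2 * ‖v‖ ^ 2) + 1) < 1 := by
        have hden : 0 < 4 * (K * κ ^ 2 * ‖v‖ ^ 2) + 1 := by positivity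
        calc |c 0| * (4 * (K * κ ^ 2 * ‖v‖ ^ 2) + 1)
            < 1 / (4 * (K * κ ^ 2 * ‖v‖ ^ 2) + 1) * (4 * (K * κ ^ 2 * ‖v‖ ^ 2) + 1) := by gcongr
          _ = 1 := by field_simp
      have h5 : (c 0) ^ 2 * (4 * (K * κ ^ 2 * ‖v‖ ^ 2)) ≤ |c 0| * (4 * (K * κ ^ 2 * ‖v‖ ^ 2)) :=
        mul_le_mul_of_nonneg_right h3 (by positivity)
      nlinarith [abs_nonneg (c 0), h4, h5, h2]
    -- remainder bound at `γ c`
    have hr := hrem (γ c) hγρ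
    rw [hℓγ] at hr
    have hnsq : ‖γ c‖ ^ 2 ≤ 2 * ((c 0) ^ 2 * ‖w‖ ^ 2) + 2 * (κ ^ 2 * (c 0) ^ 4 * ‖v‖ ^ 2) := by
      have ha : ‖(c 0) • w‖ = |c 0| * ‖w‖ := by rw [norm_smul, Real.norm_eq_abs]
      have hb : ‖(κ * (c 0) ^ 2) • v‖ = κ * (c 0) ^ 2 * ‖v‖ := by
        rw [norm_smul, Real.norm_eq_abs, abs_mul, abs_of_pos hκpos, abs_pow, sq_abs]
      have hle : ‖γ c‖ ≤ |c 0| * ‖w‖ + κ * (c 0) ^ 2 * ‖v‖ := by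
        calc ‖γ c‖ ≤ ‖(c 0) • w‖ + ‖(κ * (c 0) ^ 2) • v‖ := norm_add_le _ _
          _ = _ := by rw [ha, hb]
      have hx : 0 ≤ |c 0| * ‖w‖ := by positivity
      have hy : 0 ≤ κ * (c 0) ^ 2 * ‖v‖ := by positivity
      calc ‖γ c‖ ^ 2 ≤ (|c 0| * ‖w‖ + κ * (c 0) ^ 2 * ‖v‖) ^ 2 := by gcongr
        _ ≤ 2 * (|c 0| * ‖w‖) ^ 2 + 2 * (κ * (c 0) ^ 2 * ‖v‖) ^ 2 := by nlinarith [sq_nonneg (|c 0| * ‖w‖ - κ * (c 0) ^ 2 * ‖v‖)]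
        _ = _ := by rw [mul_pow, sq_abs]; ring
    have hlow : κ * (c 0) ^ 2 - K * ‖γ c‖ ^ 2 ≤ φ (γ c) := by
      have := (abs_sub_le_iff.mp hr).2
      linarith
    have hkey : K * ‖γ c‖ ^ 2 ≤ (κ - 1 / 2) * (c 0) ^ 2 := by
      calc K * ‖γ c‖ ^ 2 ≤ K * (2 * ((c 0) ^ 2 * ‖w‖ ^ 2) + 2 * (κ ^ 2 * (c 0) ^ 4 * ‖v‖ ^ 2)) := by gcongr
        _ = (2 * K * ‖w‖ ^ 2) * (c 0) ^ 2 + ((c 0) ^ 2 * (2 * (K * κ ^ 2 * ‖v‖ ^ 2))) * (c 0) ^ 2 := by ring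
        _ ≤ (2 * K * ‖w‖ ^ 2) * (c 0) ^ 2 + (1 / 2) * (c 0) ^ 2 := by gcongr
        _ = (κ - 1 / 2) * (c 0) ^ 2 := by rw [hκ]; ring
    nlinarith
  -- the composed curve and its globalisation
  have hloc : ∀ c : EuclideanSpace ℝ (Fin 1), c ≠ 0 → ‖c‖ < δ → P (G (γ c)) :=
    fun c hc hcδ ↦ hside (γ c) (hgood c hc hcδ).1 (hgood c hc hcδ).2
  have htame : InitialDataSet.IsTameDataFamily e 1 (fun c ↦ G (γ c)) :=
    hG.comp_contDiff hγsmooth hγ0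
  have himm' : InitialDataSet.IsImmersedAtZero 1 (fun c ↦ G (γ c)) :=
    himm.comp_of_injective_fderiv hγ0 hγdiff hγfderiv_inj
  have hinj' : Injective (fun c ↦ G (γ c)) := hinj.comp hγinj
  have h𝓓' : ∀ c, (fun c ↦ G (γ c)) c ∈ 𝓓 := fun c ↦ h𝓓 _
  obtain ⟨F, hF, hF0, hFinj, hFimm, hF𝓓, hFP⟩ :=
    InitialDataSet.exists_tameFamily_of_local (P := P) htame himm' hinj' h𝓓' hδpos hloc
  have hF0' : F 0 = G 0 := hF0.trans (congrArg G hγ0)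
  exact ⟨F, hF, hF0', hFinj, hFimm, hF𝓓, hFP⟩


/-- **Transversal crossing of a wall that is a graph** (recorded for contrast with the one-sided
osculation; it is the sibling crux's `transversal_escape` shape in the simplest chart). If the
`P`-failing parameters near `0` lie in a graph `{a = w b}` over the second coordinate with
`w 0 = 0`, then the first coordinate axis meets it only at `0`, so the axis escapes; here BOTH
sides of the wall are crossed and must be good, while no regularity of `w` is needed in this
chart (the Lipschitz cone condition of the general statement only serves to bring a transversal
line into this position). -/
theorem transversal_escape_of_graphWall {e : AFEnd X} {𝓓 : Set (InitialDataSet (𝓡 3) X)}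
    {P : InitialDataSet (𝓡 3) X → Prop} {G : EuclideanSpace ℝ (Fin 2) → InitialDataSet (𝓡 3) X}
    (hG : InitialDataSet.IsTameDataFamily e 2 G) (himm : InitialDataSet.IsImmersedAtZero 2 G)
    (hinj : Injective G) (h𝓓 : ∀ c, G c ∈ 𝓓) {w : ℝ → ℝ} (hw0 : w 0 = 0)
    (hwall : ∃ ε > (0 : ℝ), ∀ c : EuclideanSpace ℝ (Fin 2), ‖c‖ < ε → ¬ P (G c) → c 0 = w (c 1)) :
    ∃ F : EuclideanSpace ℝ (Fin 1) → InitialDataSet (𝓡 3) X,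
      InitialDataSet.IsTameDataFamily e 1 F ∧ F 0 = G 0 ∧ Injective F ∧
        InitialDataSet.IsImmersedAtZero 1 F ∧ (∀ c, F c ∈ 𝓓) ∧ ∀ c ≠ 0, P (F c) := by
  classical
  obtain ⟨ε, hε, hwall⟩ := hwall
  set e₀ : EuclideanSpace ℝ (Fin 2) := EuclideanSpace.single 0 1 with he₀
  -- the axis `γ c = (c 0) • e₀`
  set γ : EuclideanSpace ℝ (Fin 1) → EuclideanSpace ℝ (Fin 2) := fun c ↦ (c 0) • e₀ with hγ
  have hproj : ContDiff ℝ ∞ (fun c : EuclideanSpace ℝ (Fin 1) ↦ c 0) :=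
    contDiff_piLp_apply (p := 2) (i := (0 : Fin 1))
  have hγsmooth : ContDiff ℝ ∞ γ := hproj.smul contDiff_const
  have hγ0 : γ 0 = 0 := by simp [hγ]
  have he₀ne : e₀ ≠ 0 := by
    intro h
    have := congrArg (fun v : EuclideanSpace ℝ (Fin 2) ↦ v 0) h
    simp [he₀] at this
  have hγderiv : HasFDerivAt γ
      ((PiLp.proj (𝕜 := ℝ) 2 (fun _ : Fin 1 ↦ ℝ) (0 : Fin 1)).smulRight e₀) 0 :=
    (PiLp.hasFDerivAt_apply (𝕜 := ℝ) 2 (0 : EuclideanSpace ℝ (Fin 1)) (0 : Fin 1)).smul_const e₀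
  have hγdiff : DifferentiableAt ℝ γ 0 := hγderiv.differentiableAt
  have hγfderiv_inj : Injective (fderiv ℝ γ 0) := by
    rw [hγderiv.fderiv]
    intro c c' h
    simp only [ContinuousLinearMap.smulRight_apply, PiLp.proj_apply] at h
    have h' : (c 0 - c' 0) • e₀ = 0 := by
      rw [sub_smul, sub_eq_zero]; exact h
    have h'' : c 0 = c' 0 := by
      rcases smul_eq_zero.mp h' with h0 | h0
      · exact sub_eq_zero.mp h0
      · exact absurd h0 he₀ne
    ext i
    fin_cases i
    simpa using h''
  have hγinj : Injective γ := by
    intro c c' h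
    have h' : (c 0 - c' 0) • e₀ = 0 := by
      rw [sub_smul, sub_eq_zero]; exact h
    have h'' : c 0 = c' 0 := by
      rcases smul_eq_zero.mp h' with h0 | h0
      · exact sub_eq_zero.mp h0
      · exact absurd h0 he₀ne
    ext i
    fin_cases i
    simpa using h''
  have hγ0coord : ∀ c : EuclideanSpace ℝ (Fin 1), γ c 0 = c 0 := by
    intro c; simp [hγ, he₀]
  have hγ1coord : ∀ c : EuclideanSpace ℝ (Fin 1), γ c 1 = 0 := by
    intro c; simp [hγ, he₀]
  have hnormγ : ∀ c : EuclideanSpace ℝ (Fin 1), ‖γ c‖ = ‖c‖ := by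
    intro c
    rw [hγ, norm_smul, he₀, PiLp.norm_single, norm_one, mul_one, Real.norm_eq_abs, norm_fin_one]
  -- goodness off `0` on the `ε`-ball
  have hloc : ∀ c : EuclideanSpace ℝ (Fin 1), c ≠ 0 → ‖c‖ < ε → P (G (γ c)) := by
    intro c hc hcε
    by_contra hP
    have hcoord := hwall (γ c) (by rw [hnormγ]; exact hcε) hP
    rw [hγ0coord, hγ1coord, hw0] at hcoord
    exact hc (eq_zero_of_apply_fin_one hcoord)
  obtain ⟨F, hF, hF0, hFinj, hFimm, hF𝓓, hFP⟩ :=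
    InitialDataSet.exists_tameFamily_of_local (P := P) (hG.comp_contDiff hγsmooth hγ0)
      (himm.comp_of_injective_fderiv hγ0 hγdiff hγfderiv_inj) (hinj.comp hγinj) (fun c ↦ h𝓓 _)
      hε hloc
  exact ⟨F, hF, hF0.trans (congrArg G hγ0), hFinj, hFimm, hF𝓓, hFP⟩

end Osculation

/-- **Over-focusing wall (the Transfer `C⁺` of card `overfocus-only-osculation`, censored landing).**
Through every admissible datum with an incomplete MGHD pass an end `e`, a tame immersed injective
admissible 2-probe `G` and a `C²` functional `φ` on the parameter plane, `φ 0 = 0`, `dφ(0) ≠ 0`,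
such that the open side `{φ > 0}` near `0` consists of CENSORED data (the black-hole side: a closed
trapped surface forms before the first naked point and `𝓘⁺` is complete). Nothing is claimed about
`{φ ≤ 0}` (the dispersive side). -/
def OverfocusingWall : Prop :=
  ∀ (X : Type) [TopologicalSpace X] [ChartedSpace E3 X] [IsManifold (𝓡 3) ((⊤ : ℕ∞) : WithTop ℕ∞) X]
    [T2Space X] [SecondCountableTopology X] [ConnectedSpace X],
    ∀ D ∈ admissibleVacuumData X,
      (∃ 𝒟 : VacuumCauchyDevelopment D, 𝒟.IsMaximal ∧
        ¬ Summit.FinalStateConjecture.HasCompleteNullInfinity 𝒟.toCauchyDevelopment) →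
      ∃ (e : AFEnd X) (G : EuclideanSpace ℝ (Fin 2) → InitialDataSet (𝓡 3) X)
        (φ : EuclideanSpace ℝ (Fin 2) → ℝ),
        InitialDataSet.IsTameDataFamily e 2 G ∧ InitialDataSet.IsImmersedAtZero 2 G ∧ G 0 = D ∧
          Injective G ∧ (∀ c, G c ∈ admissibleVacuumData X) ∧ ContDiff ℝ 2 φ ∧ φ 0 = 0 ∧
          fderiv ℝ φ 0 ≠ 0 ∧ ∃ ε > (0 : ℝ), ∀ c, ‖c‖ < ε → 0 < φ c → Censored X (G c)

/-- **Card `overfocus-only-osculation`, composition (PROVED, the first lemma being proved):**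
`OverfocusingWall → NakedTameCensoredExit`, hence with §1 the crux. -/
theorem nakedTameCensoredExit_of_overfocusingWall (h : OverfocusingWall) :
    NakedTameCensoredExit := by
  intro X _ _ _ _ _ _ D hD hnaked
  obtain ⟨e, G, φ, hG, himm, h0, hinj, h𝓓, hφ, hφ0, hdφ, hside⟩ := h X D hD hnaked
  obtain ⟨F, hF, hF0, hinjF, himmF, h𝓓F, hP⟩ :=
    osculating_escape hG himm hinj h𝓓 hφ hφ0 hdφ hside
  exact ⟨e, F, hF, himmF, hF0.trans h0, hinjF, h𝓓F, 1, one_pos, fun c hc _ ↦ hP c hc⟩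

theorem weakCosmicCensorshipTame_of_overfocusingWall (hcbg : choquetBruhat_geroch_exists_mghd_cauchy)
    (h : OverfocusingWall) : WeakCosmicCensorshipTame :=
  weakCosmicCensorshipTame_of_exit hcbg (nakedTameCensoredExit_of_overfocusingWall h)

end Summit.FinalStateConjecture.FinalStateConjecture.Cruxes.WeakCosmicCensorshipTame.Ideator1

end
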